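import Mathlib
import HarnessLib
import Summits.HubbardSuperconductivity.HubbardSuperconductivity.Theorems.KLProgrammeKLRegimeSplitFieldStrengthSectorCount
import Summits.HubbardSuperconductivity.HubbardSuperconductivity.Theorems.KLProgrammeKLRegimeSplitSelfEnergySectorLipschitz
import Summits.HubbardSuperconductivity.HubbardSuperconductivity.Theorems.KLProgrammeKLRegimeEngineFrameShiftResponseDoorCT

/-!
# Route `KLProgramme` — ENGINE child gen 8 (stmt-HubbardSuperconductivity-20437 `KLRegimeEngineV17F2`), stub (b) conj. 4 / class #7, sector-pinned currency:
# STATIC PARTS ARE FREE — the time row and the space row with a supplier-chosen static / on-site correction projected out BEFORE sectorisation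
# (cell gate-hubbard-kl, seat hubbard-kl-k3c2-p3 g9, W3 lane; located caveat «W3-SMEAR» on plan g20 (R72) leaf (N), and its exact cure)

WHY.  In sector-pinned currency a time-LOCAL (static) piece `S` of an increment is NOT invisible to the temporal first-moment bound: the scale-`s`
multipliers `F_{s,ω}(k₀,k⃗) = C_s⁻¹(√(k₀² + e²))·ζ_{s,ω}` depend on `k₀`, so the sectorised kernel `F̌_ω ∗ S ∗ F̌_{ω′}` is spread over `|t₀ − t₁| ≲ Λ_s⁻¹` and its
sector-pinned time moment is `≈ (mass of S)·Λ_s⁻¹` — with no two-leg gain available, because such pieces are FIRST order (the on-site tadpole increment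
`U·n_j(K)` of the slice, the counterterm-type static vertices).  Yet their contribution to the READ-OUT is exactly zero: `Σ̂_S(k₀,k⃗)` does not depend on `k₀`,
so `z_S ≡ 1`; likewise an on-site piece has `Σ̂_{S′}(ν, p⃗)` independent of `p⃗` and drops out of `Σ̂(ν,p⃗) − Σ̂(ν,p⃗′)`.  This file makes the projection
available to the consumer rows, so that the atom's per-increment clauses may be stated for `Δ_j − S_j` (time) and `Δ_j − S′_j` (space) with supplier-chosen
corrections (`S = 0` recovers the uncorrected rows):

* §1 `selfEnergy_finset_sum`; **`fieldStrength_sub_eq_self_of_im_selfEnergy_eq`**: if `Im Σ_S((ω₀,k⃗),σ) = Im Σ_S((−ω₀,k⃗),σ)` for both spins then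
  `z_{G − S}(k⃗) = z_G(k⃗)`; the finite-sum form;
* §2 **`abs_klFieldStrength_sub_one_le_telescope_of_deep_static`** / **`…_uniform_static`**: the cell's time telescope
  (`…FieldStrengthSectorTelescope` / `…SectorCount`) with the `j`-th moment hypothesis on the sectorised kernel of `𝒱^{(j+1)}[K] − 𝒱^{(j)}[K] − S j`,
  `S j` any Grassmann elements with symmetric `Im Σ_{S j}(±ω₀, k⃗)` at the read-out momentum — same conclusions
  `|z_n(K)(k⃗) − 1| ≤ |z_0(K)(k⃗) − 1| + 2Σ_{j<n}Σ_{ω∈A} Mt j ω`, resp. `+ 4Σ_{j<n} M̄ j`;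
* §3 **`norm_selfEnergy_increment_sub_le_of_sector_space_moment_static`**: the increment form of the shell-Lipschitz space row
  (`…SelfEnergySectorLipschitz`) with the moment hypothesis on `G₁ − G₀ − S′`, `Σ_{S′}(ν,p⃗,σ) = Σ_{S′}(ν,p⃗′,σ)`.
Identities/inequalities with explicit hypotheses; nothing about the model is asserted; nothing asserts superconductivity.
References: BGM 2006 §2.4 (2.36) (the local quadratic part is carried by the running constant `ν_h`, whose `∂_{k₀}` vanishes), §3 (3.5)–(3.6)
[cite: BenfattoGiulianiMastropietro2006].
-/

noncomputable section

namespace Summit.HubbardSuperconductivity.HubbardSuperconductivity.Theorems.TwoLegFourier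

set_option linter.dupNamespace false -- summit = problem name (single-conjunct summit), D-0017

open Finset Complex
open Literature.MathematicalPhysics.QuantumLattice Literature.Probability.LatticeModels GrassmannAlgebra
open Summit.HubbardSuperconductivity.HubbardSuperconductivity.Theorems.KLRegimeSplit
open Summit.HubbardSuperconductivity.HubbardSuperconductivity.Theorems.KLProgrammeLegKernels

variable {L M : ℕ}

/-! ## §1 Static pieces do not move the field strength -/

/-- The self-energy reading of a finite sum is the sum of the readings. -/
theorem selfEnergy_finset_sum (β : ℝ) {ι : Type*} (s : Finset ι) (S : ι → HubbardGrassmann L M) (K : FreqMomentum L M) (σ : Fin 2) :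
    selfEnergy L M β (∑ i ∈ s, S i) K σ = ∑ i ∈ s, selfEnergy L M β (S i) K σ := by
  classical
  induction s using Finset.induction_on with
  | empty => simp
  | insert a s ha ih => rw [sum_insert ha, sum_insert ha, EngineV8.selfEnergy_add', ih]

/-- **A piece with symmetric `Im Σ(±ω₀, k⃗)` has unit field strength at spin `σ`** (e.g. a time-local piece: its `Σ̂` does not depend on `k₀`). -/
theorem fieldStrengthSpin_eq_one_of_im_selfEnergy_eq [NeZero M] (β : ℝ) (S : HubbardGrassmann L M) (k : TorusSite 2 L) (σ : Fin 2)
    (hS : (selfEnergy L M β S (omega0 M, k) σ).im = (selfEnergy L M β S ((omega0 M).rev, k) σ).im) :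
    fieldStrengthSpin L M β S k σ = 1 := by
  rw [fieldStrengthSpin, hS, sub_self, zero_div, sub_zero]

/-- The spin-averaged form: `z_S(k⃗) = 1`. -/
theorem fieldStrength_eq_one_of_im_selfEnergy_eq [NeZero M] (β : ℝ) (S : HubbardGrassmann L M) (k : TorusSite 2 L)
    (hS : ∀ σ : Fin 2, (selfEnergy L M β S (omega0 M, k) σ).im = (selfEnergy L M β S ((omega0 M).rev, k) σ).im) :
    fieldStrength L M β S k = 1 := by
  rw [fieldStrength, fieldStrengthSpin_eq_one_of_im_selfEnergy_eq β S k 0 (hS 0), fieldStrengthSpin_eq_one_of_im_selfEnergy_eq β S k 1 (hS 1)]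
  norm_num

/-- **Projecting out a static piece does not change the field strength**: `z_{G − S}(k⃗) = z_G(k⃗)` whenever `Im Σ_S((ω₀,k⃗),σ) = Im Σ_S((−ω₀,k⃗),σ)`
for both spins. [cite: BenfattoGiulianiMastropietro2006, §2.4 (2.36)] -/
theorem fieldStrength_sub_eq_self_of_im_selfEnergy_eq [NeZero L] [NeZero M] (β : ℝ) (G S : HubbardGrassmann L M) (k : TorusSite 2 L)
    (hS : ∀ σ : Fin 2, (selfEnergy L M β S (omega0 M, k) σ).im = (selfEnergy L M β S ((omega0 M).rev, k) σ).im) :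
    fieldStrength L M β (G - S) k = fieldStrength L M β G k := by
  have h := fieldStrength_sub_fieldStrength_eq β G (G - S) k
  rw [sub_sub_cancel, fieldStrength_eq_one_of_im_selfEnergy_eq β S k hS, sub_self] at h
  linarith

/-- The symmetry of `Im Σ(±ω₀,k⃗)` is additive over finite sums. -/
theorem im_selfEnergy_sum_eq {β : ℝ} [NeZero M] {n : ℕ} (S : ℕ → HubbardGrassmann L M) (k : TorusSite 2 L) (σ : Fin 2)
    (hS : ∀ j < n, (selfEnergy L M β (S j) (omega0 M, k) σ).im = (selfEnergy L M β (S j) ((omega0 M).rev, k) σ).im) :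
    (selfEnergy L M β (∑ j ∈ range n, S j) (omega0 M, k) σ).im = (selfEnergy L M β (∑ j ∈ range n, S j) ((omega0 M).rev, k) σ).im := by
  rw [selfEnergy_finset_sum, selfEnergy_finset_sum, Complex.im_sum, Complex.im_sum]
  exact sum_congr rfl fun j hj => hS j (mem_range.1 hj)

/-- Finite-sum form: `z_{G − Σ_{j<n} S j}(k⃗) = z_G(k⃗)` when every `S j` has symmetric `Im Σ(±ω₀,k⃗)`. -/
theorem fieldStrength_sub_sum_eq_self_of_im_selfEnergy_eq [NeZero L] [NeZero M] (β : ℝ) (G : HubbardGrassmann L M) {n : ℕ}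
    (S : ℕ → HubbardGrassmann L M) (k : TorusSite 2 L)
    (hS : ∀ j < n, ∀ σ : Fin 2, (selfEnergy L M β (S j) (omega0 M, k) σ).im = (selfEnergy L M β (S j) ((omega0 M).rev, k) σ).im) :
    fieldStrength L M β (G - ∑ j ∈ range n, S j) k = fieldStrength L M β G k :=
  fieldStrength_sub_eq_self_of_im_selfEnergy_eq β G _ k fun σ => im_selfEnergy_sum_eq S k σ fun j hj => hS j hj σ

/-! ## §2 The time telescope with static corrections -/

section Model

/-- **THE TIME ROW WITH STATIC CORRECTIONS** (cell instance, resolution discharged): as `abs_klFieldStrength_sub_one_le_telescope_of_deep`, but the `j`-th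
temporal-moment hypothesis is on the sectorised two-leg kernel of `𝒱^{(j+1)}[K] − 𝒱^{(j)}[K] − S j`, for ANY Grassmann elements `S j` whose self-energy has
symmetric imaginary part at `(±ω₀, k⃗)` (time-local pieces — the on-site tadpole increment, static counterterm-type vertices — which the sector multipliers would
otherwise smear over `|t₀ − t₁| ≲ Λ_{s j}⁻¹`).  Conclusion unchanged: `|z_n(K)(k⃗) − 1| ≤ |z_0(K)(k⃗) − 1| + 2·Σ_{j<n} Σ_{ω∈A_{s j}(k⃗)} Mt j ω`.
[cite: BenfattoGiulianiMastropietro2006, (2.36), §3 (3.6)] -/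
theorem abs_klFieldStrength_sub_one_le_telescope_of_deep_static [NeZero L] [NeZero M] {β : ℝ} (hβ : 0 < β) (U μ : ℝ) (K : TrigPolyC4v)
    (k : TorusSite 2 L) {n : ℕ} (s : ℕ → ℕ)
    (hdeep : ∀ j < n, Real.sqrt ((Real.pi / β) ^ 2 + nambuXiCT L μ K k ^ 2) ≤ klScale klE0 (s j + 1))
    (S : ℕ → HubbardGrassmann L M)
    (hS : ∀ j < n, ∀ σ : Fin 2, (selfEnergy L M β (S j) (omega0 M, k) σ).im = (selfEnergy L M β (S j) ((omega0 M).rev, k) σ).im)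
    {Mt : ∀ j : ℕ, Fin (sectorCount (s j)) → ℝ}
    (hMt : ∀ j < n, ∀ (σ : Fin 2),
      ∀ ω ∈ univ.filter (fun ω : Fin (sectorCount (s j)) => klAnisoFamily L M β μ K klE0 (s j) ω (omega0 M, k) ≠ 0),
      ∀ x₀ : SpaceTimeIdx L M, imagTimeWeight β M *
      ∑ x ∈ (univ : Finset (Fin 2 → SpaceTimeIdx L M)).filter (fun x => x 0 = x₀),
        ∑ ω' ∈ univ.filter (fun ω : Fin (sectorCount (s j)) => klAnisoFamily L M β μ K klE0 (s j) ω (omega0 M, k) ≠ 0),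
        imagTimeWeight β M * (circDist (2 * M) (x 0).1.val (x 1).1.val : ℝ) *
          ‖sectorisedKernel L M β (klAnisoFamily L M β μ K klE0 (s j))
              (klEffectiveAction L M β U μ K klE0 (j + 1) - klEffectiveAction L M β U μ K klE0 j - S j) 2
              (![((ω, σ), 0), ((ω', σ), 1)] : Fin 2 → SectorLeg (sectorCount (s j))) x‖ ≤ Mt j ω) :
    |klFieldStrength L M β U μ K n k - 1| ≤ |klFieldStrength L M β U μ K 0 k - 1| +
      2 * ∑ j ∈ range n, ∑ ω ∈ univ.filter (fun ω : Fin (sectorCount (s j)) => klAnisoFamily L M β μ K klE0 (s j) ω (omega0 M, k) ≠ 0),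
        Mt j ω := by
  -- the corrected ladder `G' j = 𝒱^{(j)}[K] − Σ_{i<j} S i`
  set G' : ℕ → HubbardGrassmann L M := fun j => klEffectiveAction L M β U μ K klE0 j - ∑ i ∈ range j, S i with hG'
  have hstep : ∀ j, G' (j + 1) - G' j = klEffectiveAction L M β U μ K klE0 (j + 1) - klEffectiveAction L M β U μ K klE0 j - S j := by
    intro j
    simp only [hG', sum_range_succ]
    abel
  have h0 : G' 0 = klEffectiveAction L M β U μ K klE0 0 := by simp [hG']
  have hn : fieldStrength L M β (G' n) k = klFieldStrength L M β U μ K n k := by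
    simp only [hG', klFieldStrength]
    exact fieldStrength_sub_sum_eq_self_of_im_selfEnergy_eq β _ S k hS
  have h := abs_fieldStrength_sub_one_le_telescope_of_sector_time_moments hβ G' (N := fun j => sectorCount (s j))
    (fun j => klAnisoFamily L M β μ K klE0 (s j))
    (fun j => univ.filter (fun ω : Fin (sectorCount (s j)) => klAnisoFamily L M β μ K klE0 (s j) ω (omega0 M, k) ≠ 0)) k
    (fun j hj => (sum_filter_klAnisoFamily_omega0_eq_one_of_le β μ K (s j) k (hdeep j hj)).1)
    (fun j hj => (sum_filter_klAnisoFamily_omega0_eq_one_of_le β μ K (s j) k (hdeep j hj)).2) (Mt := Mt)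
    (fun j hj σ ω hω x₀ => by rw [hstep]; exact hMt j hj σ ω hω x₀)
  rwa [hn, h0] at h

/-- **UNIFORM FORM WITH STATIC CORRECTIONS**: with per-increment bounds `M̄ j ≥ 0` uniform in the pinned label (and `#A_{s j}(k⃗) ≤ 2`),
`|z_n(K)(k⃗) − 1| ≤ |z_0(K)(k⃗) − 1| + 4·Σ_{j<n} M̄ j`. [cite: BenfattoGiulianiMastropietro2006, (2.36), §2.5 (2.45)] -/
theorem abs_klFieldStrength_sub_one_le_telescope_of_deep_uniform_static [NeZero L] [NeZero M] {β : ℝ} (hβ : 0 < β) (U μ : ℝ)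
    (K : TrigPolyC4v) (k : TorusSite 2 L) {n : ℕ} (s : ℕ → ℕ)
    (hdeep : ∀ j < n, Real.sqrt ((Real.pi / β) ^ 2 + nambuXiCT L μ K k ^ 2) ≤ klScale klE0 (s j + 1))
    (S : ℕ → HubbardGrassmann L M)
    (hS : ∀ j < n, ∀ σ : Fin 2, (selfEnergy L M β (S j) (omega0 M, k) σ).im = (selfEnergy L M β (S j) ((omega0 M).rev, k) σ).im)
    {Mbar : ℕ → ℝ} (hMbar0 : ∀ j < n, 0 ≤ Mbar j)
    (hMt : ∀ j < n, ∀ (σ : Fin 2),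
      ∀ ω ∈ univ.filter (fun ω : Fin (sectorCount (s j)) => klAnisoFamily L M β μ K klE0 (s j) ω (omega0 M, k) ≠ 0),
      ∀ x₀ : SpaceTimeIdx L M, imagTimeWeight β M *
      ∑ x ∈ (univ : Finset (Fin 2 → SpaceTimeIdx L M)).filter (fun x => x 0 = x₀),
        ∑ ω' ∈ univ.filter (fun ω : Fin (sectorCount (s j)) => klAnisoFamily L M β μ K klE0 (s j) ω (omega0 M, k) ≠ 0),
        imagTimeWeight β M * (circDist (2 * M) (x 0).1.val (x 1).1.val : ℝ) *
          ‖sectorisedKernel L M β (klAnisoFamily L M β μ K klE0 (s j))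
              (klEffectiveAction L M β U μ K klE0 (j + 1) - klEffectiveAction L M β U μ K klE0 j - S j) 2
              (![((ω, σ), 0), ((ω', σ), 1)] : Fin 2 → SectorLeg (sectorCount (s j))) x‖ ≤ Mbar j) :
    |klFieldStrength L M β U μ K n k - 1| ≤ |klFieldStrength L M β U μ K 0 k - 1| + 4 * ∑ j ∈ range n, Mbar j := by
  have h := abs_klFieldStrength_sub_one_le_telescope_of_deep_static (L := L) (M := M) hβ U μ K k s hdeep S hS
    (Mt := fun j _ => Mbar j) hMt
  refine h.trans ?_
  have hsum : ∑ j ∈ range n, ∑ ω ∈ univ.filter (fun ω : Fin (sectorCount (s j)) => klAnisoFamily L M β μ K klE0 (s j) ω (omega0 M, k) ≠ 0),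
      (fun (j : ℕ) (_ : Fin (sectorCount (s j))) => Mbar j) j ω ≤ ∑ j ∈ range n, 2 * Mbar j :=
    sum_le_sum fun j hj => sum_filter_klAnisoFamily_ne_zero_le_two_mul β μ K klE0 (s j) (omega0 M, k) (hMbar0 j (mem_range.1 hj))
      (fun _ _ => le_rfl)
  rw [← mul_sum] at hsum
  linarith

end Model

/-! ## §3 The space row (increment form) with an on-site correction -/

/-- **INCREMENT FORM OF THE SPACE ROW WITH AN ON-SITE CORRECTION**: as `norm_selfEnergy_increment_sub_le_of_sector_space_moment`, with the spatial-moment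
hypothesis on the sectorised two-leg kernel of `G₁ − G₀ − S′` for any `S′` whose self-energy at `(ν, ·, σ)` takes the same value at `p⃗` and `p⃗′` (an on-site
piece: `Σ̂_{S′}(ν, p⃗)` is independent of `p⃗`).  Conclusion unchanged. [cite: BenfattoGiulianiMastropietro2006, §3 (3.5)–(3.6)] -/
theorem norm_selfEnergy_increment_sub_le_of_sector_space_moment_static [NeZero L] [NeZero M] {N : ℕ} {β : ℝ} (hβ : 0 < β)
    (F : Fin N → FreqMomentum L M → ℂ) (G₁ G₀ S' : HubbardGrassmann L M) (ν : MatsubaraIdx M) (p p' : TorusSite 2 L) (σ : Fin 2)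
    (hS' : selfEnergy L M β S' (ν, p) σ = selfEnergy L M β S' (ν, p') σ)
    {A : Finset (Fin N)} (hA : ∑ ω ∈ A, F ω (ν, p) = 1) (hA' : ∑ ω ∈ A, F ω (ν, p') = 1) {Ms : Fin N → ℝ}
    (hMs : ∀ ω ∈ A, ∀ x₀ : SpaceTimeIdx L M, imagTimeWeight β M *
      ∑ x ∈ (univ : Finset (Fin 2 → SpaceTimeIdx L M)).filter (fun x => x 0 = x₀), ∑ ω' ∈ A,
        (|((((x 0).2 - (x 1).2) 0).valMinAbs : ℝ)| + |((((x 0).2 - (x 1).2) 1).valMinAbs : ℝ)|) *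
          ‖sectorisedKernel L M β F (G₁ - G₀ - S') 2 (![((ω, σ), 0), ((ω', σ), 1)] : Fin 2 → SectorLeg N) x‖ ≤ Ms ω) :
    ‖(selfEnergy L M β G₁ (ν, p) σ - selfEnergy L M β G₀ (ν, p) σ) -
        (selfEnergy L M β G₁ (ν, p') σ - selfEnergy L M β G₀ (ν, p') σ)‖ ≤
      2 * (2 * Real.pi / L * max |(((p - p') 0).valMinAbs : ℝ)| |(((p - p') 1).valMinAbs : ℝ)|) * ∑ ω ∈ A, Ms ω := by
  have h := norm_selfEnergy_increment_sub_le_of_sector_space_moment hβ F (G₁ - S') G₀ ν p p' σ hA hA' (Ms := Ms)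
    (fun ω hω x₀ => by rw [sub_right_comm]; exact hMs ω hω x₀)
  have heq : (selfEnergy L M β G₁ (ν, p) σ - selfEnergy L M β G₀ (ν, p) σ) -
        (selfEnergy L M β G₁ (ν, p') σ - selfEnergy L M β G₀ (ν, p') σ) =
      (selfEnergy L M β (G₁ - S') (ν, p) σ - selfEnergy L M β G₀ (ν, p) σ) -
        (selfEnergy L M β (G₁ - S') (ν, p') σ - selfEnergy L M β G₀ (ν, p') σ) := by
    rw [selfEnergy_sub, selfEnergy_sub, hS']; ring
  rw [heq]; exact h

end Summit.HubbardSuperconductivity.HubbardSuperconductivity.Theorems.TwoLegFourier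

end
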